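import Summits.QuantumFields.YangMills.Theorems.BalabanUVNodesN20CoreEdgeShellDial
import Summits.QuantumFields.YangMills.Theorems.BalabanUVNodesK3V5Defs

/-!
# BalabanUVNodes ∕ N20 (NE7b) — the `hedge`-JOINT COMPANION, module 13b: module 13's shell-dial theorems IN K3⁷ v5's REGISTERED NAMES (`K3V5Defs` BY NAME) —
# three of stub 2's five conjuncts from NO estimate at the ℓ¹-optimal shell split, the fourth (`KeyedShellWeight`) from ONE summability letter

Cell `pub-ymgap` (HUMAN RULING D-0062 Track A; D-0149 width push), seat `pub-ymgap-dag-n20-w3` (WIDTH SEAT 3 of 3 on NODE n20 = NE7b) gen 5, CLAIM-2 ∕ INTENT-2 + DECL-DELTA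
(pub-ymgap INBOX): the §3 of the announced `Thm/BalabanUVNodesN20CoreEdgeShellDial` moved to THIS companion so that module 13 stays outside the route file's import cone
(`K3V5Defs` imports `Theses.BalabanUVNodes`; gate lint `theses-cone`).  Filed `--kind proof --supports stmt-QuantumFields-20544 --as helper`; COUNT-NEUTRAL.

WHAT (all [bookkeeping] over module 13 §2 and dag-n27-w1's by-name mirror `K3V5Defs` p606160 of skeleton v5 941dddb108cbaacf): with `sh⋆` the ℓ¹-OPTIMAL shell split at a constant
reading `cK` (module 13 `exists_optShellSplit`) and `cr⋆ := fun F θ hP g₀ os ↦ crOfRecord₁₃V (jc F θ hP g₀ os) sh⋆ F θ hP g₀ os` (dag-n20-d's physical-volume reading of record, pinned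
EVERYWHERE): `pinnedAtLive_crOfRecord₁₃V` (rfl) · ★★★ `keyedCoreEdgeHolderD4_crOfRecord₁₃V_optShell` — `KeyedCoreEdgeHolderD4 β cr⋆ rr` for EVERY `β`, EVERY rate reading `rr`
(`PHolderD4` UNREAD), EVERY cut reading `jc`, EVERY constant reading · ★★ `pinned_relWeight_coreEdge_optShell` — at `jc := 0`: `PinnedAtLive ∧ KeyedRelWeight ∧ KeyedCoreEdgeHolderD4`
from NO estimate (N20 by dag-n20-w2's cut-zero face p590852) · ★★ `keyedShellWeight_crOfRecord₁₃V_optShell_of_l1Mismatch` — `KeyedShellWeight cr⋆` from ONE letter per guarded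
admissible tuple: «the one-sided ℓ¹ mismatch fractions of `(weightB₁₃, e^{c_K}·weightA₁₃)` over `classSet₁₃` are `≤ w K` on `|t| ≤ 1`, `0 ≤ w` summable» (inline, no def).
LOCATED meaning (module 13's header; plan g83 WORDS-1b (D) booked the pin risk for v6): under the free `∃ sh` the N19′ slot is dischargeable by dials and the two-run content of
stub 2 at the pinned key sits in `KeyedShellWeight cr⋆` (+ `KeyedExtraction`: live line = dag-n20-d's theorem under (H-U)∕(H-ζ), off it the one-term ∕ glued readings of dag-n20-w1
p598780 ∕ dag-n27-c).  The necessity half («no dial rescues under (Q) ∧ (ACn)») is dag-n20-w5's p606977 + companions BY NAME.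

HONEST FRAMING.  Bookkeeping; NO estimate proved; the ℓ¹ letter is a HYPOTHESIS (A2: inhabited for no Bałaban family today; it IS the two-run UV-stability content at the pinned
key, NOT PRINTED for `d = 4`, NOT proved); the hypothesis-free theorems say where the registered text puts its content, not that the content holds; NOT a refutation; no stub is
proved (the fifth conjunct `KeyedExtraction` and the letter are open); nothing of Bałaban's asserted beyond `0 ≤` class weights; count-neutral; N19 ∕ N20 ∕ N21 NOT discharged; K3⁷
NOT closed; counts unmoved (typed 28∕28 · discharged 5∕27).  One finite `𝕋⁴_{L^K}` programme at fixed `ε = L^{−K}`, Bałaban AS PRINTED; the YM mass gap (Clay) is NOT proved by any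
of this — R4 closes the conditional finite-𝕋⁴ rung `BalabanLadder.UV` only; NOT ℝ⁴, NOT continuum, NOT OS.  No `def`, no `instance`, no `notation`, no `sorry`.
Sources (location only): [King1986] (3.10)–(3.13) pp.656–657; [Balaban1989LargeFieldI] p.193; [Balaban1989LargeFieldII] Thm 1 + (0.1) pp.355–356.
-/

noncomputable section

open Finset
open scoped BigOperators

namespace Summit.QuantumFields.YangMills.BalabanUVNodes.N20CoreEdgeShellDial

open Literature.MathematicalPhysics.QuantumFieldTheory.Balaban1983to89
open Literature.MathematicalPhysics.QuantumFieldTheory.Balaban1983to89.T4Continuum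
open Literature.MathematicalPhysics.QuantumFieldTheory.Balaban1983to89.Node00
open T4WeightBudget (RelWeightBound)
open T4IndicatorShell (ShellWeightBound)
open T4ContinuumYM4Torus (ForSmallCouplings)
open Summit.QuantumFields.BalabanUV.T4Continuum.Spine
open YMDAG.UVSplit

/-! ## §3 In K3⁷ v5's registered names (`K3V5Defs` BY NAME): three of stub 2's five conjuncts from NO estimate, the fourth from ONE summability letter -/

section K3V5

open Summit.QuantumFields.YangMills.Theorems.K3V5Defs (RateReadingFn CutReading PHolderD4 KeyedRelWeight KeyedShellWeight KeyedCoreEdgeHolderD4 PinnedAtLive)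

-- A CONSTANT READING `cK`: the `Core` constants `K ↦ c_K` read PER TUPLE, like the cut reading `jc` ((t-JC)) — the third dial of stub 2 (a bare function type, no def).
variable (jc : CutReading) (sh : ShellSplit₁₃CoPH 2 0)
  (cK : (F : T4Family) → (θ : Stage13HParams F 2) → θ.Provisos₁₃CoPH F 2 → (ℕ → ℝ) → List (ULoop F) → ℕ → ℝ)

/-- `PinnedAtLive` for the reading of record pinned EVERYWHERE (any `jc`, any `sh`; `rfl`). [bookkeeping] -/
theorem pinnedAtLive_crOfRecord₁₃V : PinnedAtLive jc sh (fun F θ hP g₀ os => crOfRecord₁₃V (jc F θ hP g₀ os) sh F θ hP g₀ os) :=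
  fun _ _ _ _ _ _ => rfl

/-- **★★★ THE N19′ CONJUNCT OF `stub_expansion13H` HOLDS AT THE ℓ¹-OPTIMAL SHELL SPLIT — FOR EVERY `β`, EVERY RATE READING, EVERY CUT READING, EVERY CONSTANT READING.**
`KeyedCoreEdgeHolderD4 β cr⋆ rr` with `cr⋆ := crOfRecord₁₃V (jc …) sh⋆` pinned everywhere: under the crux's prefix and `ForSmallCouplings` (by `.of_forall`), the hypothesis
`PHolderD4 β D (rr …)` is NOT READ, and `∃ δ, Core … ∧ Summable δ` is §2's `core_crOfRecord₁₃VAt_optShell` at `K₀ = 0`.  Located meaning: under v5's free `∃ sh` the N19′ slot is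
dischargeable by dials; the two-run content it was meant to carry moves to `KeyedShellWeight cr⋆` (below). [cite: King1986, (3.10)–(3.13) pp.656–657 (template only)] [bookkeeping] -/
theorem keyedCoreEdgeHolderD4_crOfRecord₁₃V_optShell (β : ℝ) (rr : RateReadingFn)
    (hsh : ∀ (F : T4Family) (θ : Stage13HParams F 2) (hP : θ.Provisos₁₃CoPH F 2) (g₀ : ℕ → ℝ) (os : List (ULoop F)),
      sh F θ hP g₀ os =
        (fun K t x => max 0 (weightA₁₃ θ hP 0 g₀ os K t x - Real.exp (-cK F θ hP g₀ os K) * weightB₁₃ θ hP 0 g₀ os K t x),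
         fun K t x => max 0 (weightB₁₃ θ hP 0 g₀ os K t x - Real.exp (cK F θ hP g₀ os K) * weightA₁₃ θ hP 0 g₀ os K t x))) :
    KeyedCoreEdgeHolderD4 β (fun F θ hP g₀ os => crOfRecord₁₃V (jc F θ hP g₀ os) sh F θ hP g₀ os) rr := by
  intro F θ hP _ _ _ _
  refine ForSmallCouplings.of_forall fun g₀ os _ => ?_
  exact ⟨_, core_crOfRecord₁₃VAt_optShell 0 (jc F θ hP g₀ os) sh θ hP g₀ os (cK F θ hP g₀ os) (hsh F θ hP g₀ os)⟩

/-- **★★ THREE OF STUB 2's FIVE CONJUNCTS FROM NO ESTIMATE**: at `jc := 0` and the ℓ¹-optimal shell split, with `cr⋆` pinned everywhere, `PinnedAtLive ∧ KeyedRelWeight ∧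
KeyedCoreEdgeHolderD4 β cr⋆ rr` hold for EVERY `β` and EVERY rate reading (N20 by dag-n20-w2's cut-zero face p590852, N19′ by the theorem above).  What remains of the registered
text is `KeyedExtraction cr⋆` (on the live line dag-n20-d's theorem under (H-U)∕(H-ζ); off it the one-term reading, dag-n20-w1 p598780 ∕ dag-n27-c's glued readings) and
`KeyedShellWeight cr⋆` — the next theorem's ONE letter. [cite: King1986, (3.10)–(3.13) pp.656–657 (template only)] [bookkeeping] -/
theorem pinned_relWeight_coreEdge_optShell (β : ℝ) (rr : RateReadingFn)
    (hsh : ∀ (F : T4Family) (θ : Stage13HParams F 2) (hP : θ.Provisos₁₃CoPH F 2) (g₀ : ℕ → ℝ) (os : List (ULoop F)),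
      sh F θ hP g₀ os =
        (fun K t x => max 0 (weightA₁₃ θ hP 0 g₀ os K t x - Real.exp (-cK F θ hP g₀ os K) * weightB₁₃ θ hP 0 g₀ os K t x),
         fun K t x => max 0 (weightB₁₃ θ hP 0 g₀ os K t x - Real.exp (cK F θ hP g₀ os K) * weightA₁₃ θ hP 0 g₀ os K t x))) :
    PinnedAtLive (fun _ _ _ _ _ _ => 0) sh (fun F θ hP g₀ os => crOfRecord₁₃V (fun _ => 0) sh F θ hP g₀ os) ∧
      KeyedRelWeight (fun F θ hP g₀ os => crOfRecord₁₃V (fun _ => 0) sh F θ hP g₀ os) ∧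
      KeyedCoreEdgeHolderD4 β (fun F θ hP g₀ os => crOfRecord₁₃V (fun _ => 0) sh F θ hP g₀ os) rr :=
  ⟨pinnedAtLive_crOfRecord₁₃V (fun _ _ _ _ _ _ => 0) sh,
    fun _ θ hP _ _ g₀ os => relWeightBound_crOfRecord₁₃VAt_cutZero 0 sh θ hP g₀ os,
    keyedCoreEdgeHolderD4_crOfRecord₁₃V_optShell (fun _ _ _ _ _ _ => 0) sh cK β rr hsh⟩

/-- **★★ THE FOURTH CONJUNCT FROM ONE SUMMABILITY LETTER PER GUARDED ADMISSIBLE TUPLE** — «the one-sided ℓ¹ mismatch fractions of `(weightB₁₃, e^{c_K}·weightA₁₃)` over the class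
set of record are `≤ w K` on `|t| ≤ 1`, `0 ≤ w` summable» ⇒ `KeyedShellWeight cr⋆` (any cut reading).  THIS LETTER IS WHERE v5's stub 2 puts the two-run UV-stability content at the
pinned key when the shell dial is used (NOT PRINTED for `d = 4`, NOT proved, inhabited for no family today — A2). [cite: Balaban1989LargeFieldII, Thm 1 + (0.1) pp.355–356 (one-run template only)] [bookkeeping] -/
theorem keyedShellWeight_crOfRecord₁₃V_optShell_of_l1Mismatch
    (hsh : ∀ (F : T4Family) (θ : Stage13HParams F 2) (hP : θ.Provisos₁₃CoPH F 2) (g₀ : ℕ → ℝ) (os : List (ULoop F)),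
      sh F θ hP g₀ os =
        (fun K t x => max 0 (weightA₁₃ θ hP 0 g₀ os K t x - Real.exp (-cK F θ hP g₀ os K) * weightB₁₃ θ hP 0 g₀ os K t x),
         fun K t x => max 0 (weightB₁₃ θ hP 0 g₀ os K t x - Real.exp (cK F θ hP g₀ os K) * weightA₁₃ θ hP 0 g₀ os K t x)))
    (hl1 : ∀ (F : T4Family) (θ : Stage13HParams F 2) (hP : θ.Provisos₁₃CoPH F 2), (θ.ZhUnity F 2 ∧ θ.SlotsNondegenerate₁₃ F 2) → θ.Admissible F 2 →
      ∀ (g₀ : ℕ → ℝ) (os : List (ULoop F)), ∃ w : ℕ → ℝ, (∀ K, 0 ≤ w K) ∧ Summable w ∧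
        (∀ (K : ℕ) (t : ℝ), |t| ≤ 1 →
          ∑ x ∈ classSet₁₃ θ 0 g₀ K, max 0 (weightA₁₃ θ hP 0 g₀ os K t x - Real.exp (-cK F θ hP g₀ os K) * weightB₁₃ θ hP 0 g₀ os K t x)
            ≤ w K * ∑ x ∈ classSet₁₃ θ 0 g₀ K, weightA₁₃ θ hP 0 g₀ os K t x) ∧
        (∀ (K : ℕ) (t : ℝ), |t| ≤ 1 →
          ∑ x ∈ classSet₁₃ θ 0 g₀ K, max 0 (weightB₁₃ θ hP 0 g₀ os K t x - Real.exp (cK F θ hP g₀ os K) * weightA₁₃ θ hP 0 g₀ os K t x)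
            ≤ w K * ∑ x ∈ classSet₁₃ θ 0 g₀ K, weightB₁₃ θ hP 0 g₀ os K t x)) :
    KeyedShellWeight (fun F θ hP g₀ os => crOfRecord₁₃V (jc F θ hP g₀ os) sh F θ hP g₀ os) := by
  intro F θ hP hG hθ g₀ os
  obtain ⟨w, hw0, hws, hmA, hmB⟩ := hl1 F θ hP hG hθ g₀ os
  exact shellWeightBound_crOfRecord₁₃VAt_optShell_of_l1Mismatch 0 (jc F θ hP g₀ os) sh θ hP g₀ os (cK F θ hP g₀ os) (hsh F θ hP g₀ os) hw0 hws hmA hmB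

end K3V5

end Summit.QuantumFields.YangMills.BalabanUVNodes.N20CoreEdgeShellDial

end
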